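import Literature.Topology.FourManifolds.SphereSurgeryCollapse
import Literature.Topology.FourManifolds.SphereSurgeryEnds
import Literature.AlgebraicTopology.SingularHomology.RelativeCochainsExcision
import Literature.AlgebraicTopology.SingularHomology.TubeCollapseCohomology
import Literature.AlgebraicTopology.SingularHomology.CohomologyMayerVietorisInjective
import HarnessLib

/-!
# The middle cohomology before and after a surgery, through the common collapse

Topic `Literature/Topology/FourManifolds` (fact seat of
`Literature.Topology.FourManifolds.HomotopySphere.exists_highlyConnected_of_mem_signatureSet`,
brick B6e).  M. Kervaire, J. Milnor, *Groups of homotopy spheres I*, Ann. of Math. 77 (1963),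
§5 (Lemma 5.6) and A. Kosinski, *Differential Manifolds* (1993), X.1 Prop. (1.1): a surgery on a
`k`-sphere in `W` changes the (co)homology only in degrees `k`, `k + 1` and the dual degrees;
here for the closed models `Ŵ`, `χ̂` (footnote pp. 528–529) and organised through the common
collapse `π : Ŵ → Z = U⁺ ← χ̂ : π'` of `SphereSurgeryCollapse.lean` and the compact part `K₀` of
`U` of `SphereSurgeryEnds.lean`:

* `relSingularCohomology.isIso_map_of_isOpenEmbedding'` — **relative cohomology at a compact
  set is local**: `f^* : Hⁿ(X, X ∖ f K) ≅ Hⁿ(Y, Y ∖ K)` for an open embedding `f`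
  (Hatcher Thm. 2.20, cohomological form);
* `NullCobordism.bijective_relMap_collapseX`, `bijective_relMap_collapseP` — **`π^*` and `π'^*`
  are bijective on `Hⁿ(·, · ∖ K)`** for every compact `K ⊆ U` (all three pairs excise to
  `(U, U ∖ K)`);
* `NullCobordism.nonempty_coneP_homeomorph_coneNhd` — the thin cone neighbourhoods of `∞` in `χ̂`
  and `Ŵ` are homeomorphic (both are carried by the collapses homeomorphically onto one compact
  subset of `Z`, together with their compact closures), so `Hʲ(N'; ℤ) = 0` for `j ≠ 0`;
* `NullCobordism.isZero_singularCohomology_endsX`, `isZero_singularCohomology_endsP` —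
  `Hʲ(Ŵ ∖ ι_X K₀; ℤ) = 0` for `2 ≤ j ≠ k` and `Hʲ(χ̂ ∖ ι_P K₀; ℤ) = 0` for `2 ≤ j ≠ l`;
* `NullCobordism.surjective_toAbsolute_X`, `injective_toAbsolute_P`, `bijective_toAbsolute_P` —
  the exact sequences of the pairs: `Hᵖ(Ŵ, Ŵ ∖ ι_X K₀) ↠ Hᵖ(Ŵ)` for `2 ≤ p`, `k < p`;
  `Hᵖ(χ̂, χ̂ ∖ ι_P K₀) ↪ Hᵖ(χ̂)` for `3 ≤ p ≤ l`, bijective for `p < l`.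

Everything is proved; the only definition (with body) is the compact set `K₀U` (the compact
part `K₀` seen in `U`); no named facts.

## References

* M. Kervaire, J. Milnor, *Groups of homotopy spheres I*, Ann. of Math. 77 (1963), §5,
  Lemma 5.6; §7 footnote pp. 528–529. [KervaireMilnorAnnals1963]
* A. Kosinski, *Differential Manifolds* (1993), Ch. X §1, Prop. (1.1). [Kosinski1993]
* A. Hatcher, *Algebraic Topology* (2002), Thm. 2.20, §3.1 pp. 199–204. [HatcherAT2002]
-/

noncomputable section

open scoped Manifold ContDiff Topology
open Set Function Filter CategoryTheory Limits Topology Metric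
open Literature.AlgebraicTopology.SingularHomology

/-! ### §0 Relative cohomology at a compact set is local -/

namespace Literature.AlgebraicTopology.SingularHomology

namespace relSingularCohomology

variable (R : Type) [CommRing R] (G : Type) [AddCommGroup G] [Module R G]
variable {X Y : Type} [TopologicalSpace X] [TopologicalSpace Y]

/-- **Relative cohomology at a compact set is local** (Hatcher 2002, Thm. 2.20 with §3.1 p. 201):
for an open embedding `f : Y → X` into a Hausdorff space and a compact `K ⊆ Y`, the map of
pairs `(Y, Y ∖ K) → (X, X ∖ f K)` induces isomorphisms `Hⁿ(X, X ∖ f K; G) ≅ Hⁿ(Y, Y ∖ K; G)` —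
a homeomorphism onto the open `f(Y)` followed by the excision of the closed set `X ∖ f(Y)` lying
in the open `X ∖ f K`. [cite: HatcherAT2002, Thm. 2.20 and §3.1 p. 201] -/
theorem isIso_map_of_isOpenEmbedding' [T2Space X] {f : C(Y, X)} (hf : IsOpenEmbedding f)
    {K : Set Y} (hK : IsCompact K) (h : MapsTo f (Kᶜ) ((f '' K)ᶜ)) (n : ℕ) :
    IsIso (relSingularCohomology.map R G f h n) := by
  let e : Y ≃ₜ ↥(range f) := hf.isEmbedding.toHomeomorph
  have hfac : f = (subsetIncl (range f)).comp (e : C(Y, ↥(range f))) := by ext y; rfl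
  have hKc : IsClosed (f '' K) := (hK.image f.continuous).isClosed
  have hA : MapsTo (e : C(Y, ↥(range f))) (Kᶜ) (Subtype.val ⁻¹' ((f '' K)ᶜ)) := by
    intro y hy hy'
    obtain ⟨y', hy'K, h'⟩ := hy'
    exact hy (hf.injective h' ▸ hy'K)
  have hB : MapsTo (e.symm : C(↥(range f), Y)) (Subtype.val ⁻¹' ((f '' K)ᶜ)) (Kᶜ) := by
    intro z hz hzK
    apply hz
    refine ⟨e.symm z, hzK, ?_⟩
    have : (e (e.symm z) : X) = f (e.symm z) := hf.isEmbedding.toHomeomorph_apply_coe _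
    rw [← this, e.apply_symm_apply]
  haveI h1 := relSingularCohomology.isIso_map_of_homeomorph R G e hA hB n
  have hcov : interior ((f '' K)ᶜ) ∪ interior (range f) = univ := by
    rw [hKc.isOpen_compl.interior_eq, hf.isOpen_range.interior_eq]
    refine eq_univ_of_forall fun x => ?_
    by_cases hx : x ∈ range f
    · exact Or.inr hx
    · exact Or.inl fun ⟨y, _, hyx⟩ => hx ⟨y, hyx⟩
  haveI h2 := relSingularCohomology.isIso_map_subsetIncl_of_interior R G ((f '' K)ᶜ) (range f) hcov n
  rw [relSingularCohomology.map_congr hfac h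
    ((Set.mapsTo_preimage Subtype.val ((f '' K)ᶜ)).comp hA) n,
    relSingularCohomology.map_comp (e : C(Y, ↥(range f))) (subsetIncl (range f)) hA
      (Set.mapsTo_preimage Subtype.val ((f '' K)ᶜ)) n]
  exact IsIso.comp_isIso

/-- Bijectivity of an isomorphism of modules, as a function. [folklore] -/
theorem bijective_of_isIso {R : Type} [CommRing R] {A B : ModuleCat.{0} R} (f : A ⟶ B) [IsIso f] :
    Bijective f :=
  ((forget (ModuleCat R)).mapIso (asIso f)).toEquiv.bijective

end relSingularCohomology

end Literature.AlgebraicTopology.SingularHomology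

namespace Literature.Topology.FourManifolds

namespace NullCobordism

variable {m : ℕ}
variable {M : Type} [TopologicalSpace M] [ChartedSpace (EuclideanSpace ℝ (Fin (m + 1))) M]
  [IsManifold (𝓡 (m + 1)) ∞ M]
  (c : NullCobordism (m + 1) M) {ι : Type} [Unique ι] {k l : ℕ}
  (ν : FramedSphereFamily (𝓡∂ (m + 1 + 1)) c.W ι k (l + 1)) (hkl : k + l = m + 1)

/-! ### §1 `π^*` and `π'^*` are bijective on `Hⁿ(·, · ∖ K)` -/

section Bijective

omit [IsManifold (𝓡 (m + 1)) ∞ M] in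
/-- The common piece is locally compact (an open subset of a manifold). [folklore] -/
instance locallyCompactSpace_commonPiece : LocallyCompactSpace ↥(c.commonPiece ν) := by
  haveI : LocallyCompactSpace c.Interior :=
    ChartedSpace.locallyCompactSpace (EuclideanSpace ℝ (Fin (m + 1 + 1))) c.Interior
  exact (c.commonPiece ν).2.locallyCompactSpace

omit [IsManifold (𝓡 (m + 1)) ∞ M] in
/-- The collapse target `Z = U⁺` is Hausdorff. [folklore] -/
instance t2Space_collapseTarget : T2Space (c.collapseTarget ν) := inferInstance

omit [IsManifold (𝓡 (m + 1)) ∞ M] in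

/-- `ι_Z` is a map of pairs `(U, U ∖ K) → (Z, Z ∖ ι_Z K)`. [folklore] -/
theorem mapsTo_ιZ (K : Set ↥(c.commonPiece ν)) :
    MapsTo (c.ιZ ν) (Kᶜ) ((c.ιZ ν '' K)ᶜ) :=
  mapsTo_compl_image_of_injective (c.isOpenEmbedding_ιZ ν).injective K

/-- `ι_X` is a map of pairs `(U, U ∖ K) → (Ŵ, Ŵ ∖ ι_X K)`. [folklore] -/
theorem mapsTo_ιX (K : Set ↥(c.commonPiece ν)) :
    MapsTo (c.ιX ν hkl) (Kᶜ) ((c.ιX ν hkl '' K)ᶜ) :=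
  mapsTo_compl_image_of_injective (c.isOpenEmbedding_ιX ν hkl).injective K

/-- `ι_P` is a map of pairs `(U, U ∖ K) → (χ̂, χ̂ ∖ ι_P K)`. [folklore] -/
theorem mapsTo_ιP (K : Set ↥(c.commonPiece ν)) :
    MapsTo (c.ιP ν hkl) (Kᶜ) ((c.ιP ν hkl '' K)ᶜ) :=
  mapsTo_compl_image_of_injective (c.isOpenEmbedding_ιP ν hkl).injective K

/-- **`π^* : Hⁿ(Z, Z ∖ ι_Z K) → Hⁿ(Ŵ, Ŵ ∖ ι_X K)` is bijective** for `K ⊆ U` compact: composed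
with the excision isomorphism `ι_X^*` it is the excision isomorphism `ι_Z^*` (`π ∘ ι_X = ι_Z`).
[cite: HatcherAT2002, Thm. 2.20] -/
theorem bijective_relMap_collapseX {K : Set ↥(c.commonPiece ν)} (hK : IsCompact K) (n : ℕ) :
    Bijective (relSingularCohomology.map ℤ ℤ (c.collapseX ν hkl) (c.mapsTo_collapseX ν hkl K) n) := by
  haveI iX := relSingularCohomology.isIso_map_of_isOpenEmbedding' ℤ ℤ (c.isOpenEmbedding_ιX ν hkl) hK
    (c.mapsTo_ιX ν hkl K) n
  haveI iZ := relSingularCohomology.isIso_map_of_isOpenEmbedding' ℤ ℤ (c.isOpenEmbedding_ιZ ν) hK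
    (c.mapsTo_ιZ ν K) n
  have hcomp : relSingularCohomology.map ℤ ℤ (c.collapseX ν hkl) (c.mapsTo_collapseX ν hkl K) n ≫
      relSingularCohomology.map ℤ ℤ (c.ιX ν hkl) (c.mapsTo_ιX ν hkl K) n =
      relSingularCohomology.map ℤ ℤ (c.ιZ ν) (c.mapsTo_ιZ ν K) n := by
    rw [← relSingularCohomology.map_comp]
    exact relSingularCohomology.map_congr (c.collapseX_comp_ιX ν hkl) _ _ n
  haveI : IsIso (relSingularCohomology.map ℤ ℤ (c.collapseX ν hkl) (c.mapsTo_collapseX ν hkl K) n) :=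
    IsIso.of_isIso_fac_right hcomp
  exact relSingularCohomology.bijective_of_isIso _

/-- **`π'^* : Hⁿ(Z, Z ∖ ι_Z K) → Hⁿ(χ̂, χ̂ ∖ ι_P K)` is bijective** for `K ⊆ U` compact.
[cite: HatcherAT2002, Thm. 2.20] -/
theorem bijective_relMap_collapseP {K : Set ↥(c.commonPiece ν)} (hK : IsCompact K) (n : ℕ) :
    Bijective (relSingularCohomology.map ℤ ℤ (c.collapseP ν hkl) (c.mapsTo_collapseP ν hkl K) n) := by
  haveI iP := relSingularCohomology.isIso_map_of_isOpenEmbedding' ℤ ℤ (c.isOpenEmbedding_ιP ν hkl) hK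
    (c.mapsTo_ιP ν hkl K) n
  haveI iZ := relSingularCohomology.isIso_map_of_isOpenEmbedding' ℤ ℤ (c.isOpenEmbedding_ιZ ν) hK
    (c.mapsTo_ιZ ν K) n
  have hcomp : relSingularCohomology.map ℤ ℤ (c.collapseP ν hkl) (c.mapsTo_collapseP ν hkl K) n ≫
      relSingularCohomology.map ℤ ℤ (c.ιP ν hkl) (c.mapsTo_ιP ν hkl K) n =
      relSingularCohomology.map ℤ ℤ (c.ιZ ν) (c.mapsTo_ιZ ν K) n := by
    rw [← relSingularCohomology.map_comp]
    exact relSingularCohomology.map_congr (c.collapseP_comp_ιP ν hkl) _ _ n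
  haveI : IsIso (relSingularCohomology.map ℤ ℤ (c.collapseP ν hkl) (c.mapsTo_collapseP ν hkl K) n) :=
    IsIso.of_isIso_fac_right hcomp
  exact relSingularCohomology.bijective_of_isIso _

end Bijective

/-! ### §2 Points of the common piece in the two closed models and in `Z` -/

section Points

omit [IsManifold (𝓡 (m + 1)) ∞ M] in
/-- The point of `U` under an interior point of `W` off the core sphere. [folklore] -/
def uPt (x : ManifoldInterior (m + 1) c.W) (hx : x.1 ∈ (ν.complement : Set c.W)) :
    ↥(c.commonPiece ν) := ⟨⟨x.1, x.2⟩, hx⟩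

/-- `ι_X (uPt x) = x`. [folklore] -/
@[simp] theorem ιX_uPt (x : ManifoldInterior (m + 1) c.W) (hx : x.1 ∈ (ν.complement : Set c.W)) :
    c.ιX ν hkl (c.uPt ν x hx) = ClosedModel.ofInterior x :=
  c.ιX_apply_eq_ofInterior ν hkl _

/-- `π x = uPt x` for an interior point `x` off the core sphere. [folklore] -/
theorem collapseX_ofInterior (x : ManifoldInterior (m + 1) c.W) (hx : x.1 ∈ (ν.complement : Set c.W)) :
    c.collapseX ν hkl (ClosedModel.ofInterior x) = ((c.uPt ν x hx : ↥(c.commonPiece ν)) : OnePoint _) := by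
  rw [← c.ιX_uPt ν hkl x hx, c.collapseX_ιX]

/-- `π ∞ = ∞`. [folklore] -/
theorem collapseX_infty : c.collapseX ν hkl ClosedModel.infty = OnePoint.infty := by
  refine c.collapseX_apply_of_not_mem ν hkl ?_
  rintro ⟨v, hv⟩
  rw [c.ιX_apply_eq_ofInterior ν hkl v] at hv
  exact OnePoint.coe_ne_infty _ hv

/-- The point of `U` under a point of the surgery piece in the interior of `W`. [folklore] -/
def uPtA (a : ↥(c.surgeryPiece ν hkl).A) (ha : (a : c.W) ∈ (𝓡∂ (m + 1 + 1)).interior c.W) :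
    ↥(c.commonPiece ν) := ⟨⟨a, ha⟩, a.2⟩

/-- `pieceIncl (uPtA a) = a`. [folklore] -/
@[simp] theorem pieceIncl_uPtA (a : ↥(c.surgeryPiece ν hkl).A)
    (ha : (a : c.W) ∈ (𝓡∂ (m + 1 + 1)).interior c.W) :
    c.pieceIncl ν hkl (c.uPtA ν hkl a ha) = a := rfl

/-- `ι_P (uPtA a) = q'(inl a)`. [folklore] -/
theorem ιP_uPtA (a : ↥(c.surgeryPiece ν hkl).A) (ha : (a : c.W) ∈ (𝓡∂ (m + 1 + 1)).interior c.W) :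
    c.ιP ν hkl (c.uPtA ν hkl a ha) = ClosedModel.ofInterior ⟨(c.surgeryPiece ν hkl).j a,
      (c.surgeryPiece ν hkl).j_mem_interior ha⟩ :=
  c.ιP_apply_eq_ofInterior ν hkl _

/-- `π' (q'(inl a)) = uPtA a`. [folklore] -/
theorem collapseP_ofInterior_j (a : ↥(c.surgeryPiece ν hkl).A)
    (ha : (a : c.W) ∈ (𝓡∂ (m + 1 + 1)).interior c.W) :
    c.collapseP ν hkl (ClosedModel.ofInterior ⟨(c.surgeryPiece ν hkl).j a,
      (c.surgeryPiece ν hkl).j_mem_interior ha⟩) =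
      ((c.uPtA ν hkl a ha : ↥(c.commonPiece ν)) : OnePoint _) := by
  rw [← c.ιP_uPtA ν hkl a ha, c.collapseP_ιP]

/-- `π' ∞ = ∞`. [folklore] -/
theorem collapseP_infty : c.collapseP ν hkl ClosedModel.infty = OnePoint.infty := by
  refine c.collapseP_apply_of_not_mem ν hkl ?_
  rintro ⟨v, hv⟩
  rw [c.ιP_apply_eq_ofInterior ν hkl v] at hv
  exact OnePoint.coe_ne_infty _ hv

/-- An interior point of `χ` in the image of the piece comes from an interior point of `W`.
[folklore] -/
theorem mem_interior_of_j_mem_interior {a : ↥(c.surgeryPiece ν hkl).A}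
    (h : (c.surgeryPiece ν hkl).j a ∈ (𝓡∂ (m + 1 + 1)).interior (c.surgery ν hkl).W) :
    (a : c.W) ∈ (𝓡∂ (m + 1 + 1)).interior c.W := by
  rw [← ModelWithCorners.compl_boundary] at h ⊢
  exact fun hb => h (((c.surgeryPiece ν hkl).mem_boundary_iff a).1 hb)

end Points

/-! ### §3 The thin cone neighbourhoods of `∞` in `Ŵ` and `χ̂` are homeomorphic -/

section Cone

/-- A subset as a subtype of a larger subset. [folklore] -/
def _root_.Homeomorph.setSubtypeOfSubset {X : Type*} [TopologicalSpace X] {s t : Set X}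
    (h : s ⊆ t) : ↥s ≃ₜ {y : ↥t // (y : X) ∈ s} where
  toFun y := ⟨⟨y.1, h y.2⟩, y.2⟩
  invFun z := ⟨z.1.1, z.2⟩
  left_inv _ := rfl
  right_inv _ := rfl
  continuous_toFun := (continuous_subtype_val.subtype_mk _).subtype_mk _
  continuous_invFun := (continuous_subtype_val.comp continuous_subtype_val).subtype_mk _

variable (κ : c.boundaryData.Collar)

/-- A thin closed collar misses the core sphere. [folklore] -/
theorem collarBelow_subset_complement {ε : ℝ} (hthin : Disjoint (c.collarBelow κ ε) (c.closedUnitTube ν)) :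
    c.collarBelow κ ε ⊆ (ν.complement : Set c.W) := fun _ hx hc =>
  Set.disjoint_left.1 hthin hx ((c.unitTube_subset_closedUnitTube ν) (c.cores_subset_unitTube ν hc))

/-- Membership of an interior point in the cone neighbourhood `N'_ε` of `χ̂`. [folklore] -/
theorem ofInterior_mem_coneP_iff (ε : ℝ) (x : ManifoldInterior (m + 1) (c.surgery ν hkl).W) :
    ClosedModel.ofInterior x ∈ c.coneP ν hkl κ ε ↔ x.1 ∈ c.collarP ν hkl κ ε := by
  constructor
  · intro hx
    rcases (mem_insert_iff).1 hx with h | ⟨x', hx', hx'x⟩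
    · exact absurd h (OnePoint.coe_ne_infty _)
    · have hxx : x' = x := OnePoint.coe_injective hx'x
      subst hxx; exact hx'
  · intro hx; exact mem_insert_of_mem _ ⟨x, hx, rfl⟩

/-- **The thin cone neighbourhoods of `∞` in `χ̂` and in `Ŵ` are homeomorphic** (for a thin
collar `κ(∂W × [0, ε])` off the closed tube): the compact closures
`N̄ = {∞} ∪ κ(∂W × (0, ε])°`, `N̄' = {∞} ∪ (inl κ(∂W × (0, ε]))°` are carried by the collapses
`π`, `π'` continuously and injectively, hence homeomorphically (compact to Hausdorff), onto the
same subset of `Z`, and the open parts `N_ε`, `N'_ε` correspond. [cite: KervaireMilnorAnnals1963, §7, footnote pp. 528–529] -/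
theorem nonempty_coneP_homeomorph_coneNhd [CompactSpace M] [T2Space M] {ε : ℝ}
    (hthin : Disjoint (c.collarBelow κ ε) (c.closedUnitTube ν)) :
    Nonempty (↥(c.coneP ν hkl κ ε) ≃ₜ ↥(c.coneNhd κ ε)) := by
  set S := c.surgeryPiece ν hkl with hS
  have hCBc : IsCompact (c.collarBelow κ ε) := c.isCompact_collarBelow κ ε
  have hCBcompl := c.collarBelow_subset_complement ν κ hthin
  -- the compact closures
  set NX : Set (ClosedModel (m + 1) c.W) := insert ClosedModel.infty
    ((ClosedModel.ofInterior : ManifoldInterior (m + 1) c.W → _) '' {x | x.1 ∈ c.collarBelow κ ε})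
    with hNX
  set CBP : Set (c.surgery ν hkl).W := S.j '' {a | (a : c.W) ∈ c.collarBelow κ ε} with hCBP
  set NP : Set (ClosedModel (m + 1) (c.surgery ν hkl).W) := insert ClosedModel.infty
    ((ClosedModel.ofInterior : ManifoldInterior (m + 1) (c.surgery ν hkl).W → _) '' {x | x.1 ∈ CBP})
    with hNP
  have hNXc : IsCompact NX := (ClosedModel.isClosed_hat_of_isClosed hCBc.isClosed).isCompact
  have hCBPc : IsCompact CBP := by
    have h1 : IsCompact {a : ↥S.A | (a : c.W) ∈ c.collarBelow κ ε} := by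
      rw [S.isOpenEmbedding_ι.isEmbedding.isCompact_iff]
      convert hCBc using 1
      ext x; constructor
      · rintro ⟨a, ha, rfl⟩; exact ha
      · intro hx; exact ⟨⟨x, hCBcompl hx⟩, hx, rfl⟩
    exact h1.image S.j.continuous
  have hNPc : IsCompact NP := (ClosedModel.isClosed_hat_of_isClosed hCBPc.isClosed).isCompact
  haveI : CompactSpace ↥NX := isCompact_iff_compactSpace.1 hNXc
  haveI : CompactSpace ↥NP := isCompact_iff_compactSpace.1 hNPc
  -- the two maps to `Z`
  let fX : ↥NX → c.collapseTarget ν := fun y => c.collapseX ν hkl y.1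
  let fP : ↥NP → c.collapseTarget ν := fun y => c.collapseP ν hkl y.1
  have hfXc : Continuous fX := (c.collapseX ν hkl).continuous.comp continuous_subtype_val
  have hfPc : Continuous fP := (c.collapseP ν hkl).continuous.comp continuous_subtype_val
  -- values
  have vX : ∀ (x : ManifoldInterior (m + 1) c.W) (hx : x.1 ∈ c.collarBelow κ ε),
      c.collapseX ν hkl (ClosedModel.ofInterior x) = ((c.uPt ν x (hCBcompl hx) : ↥(c.commonPiece ν)) : OnePoint _) :=
    fun x hx => c.collapseX_ofInterior ν hkl x (hCBcompl hx)
  have vP : ∀ (a : ↥S.A) (ha : (a : c.W) ∈ (𝓡∂ (m + 1 + 1)).interior c.W),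
      c.collapseP ν hkl (ClosedModel.ofInterior ⟨S.j a, S.j_mem_interior ha⟩) =
        ((c.uPtA ν hkl a ha : ↥(c.commonPiece ν)) : OnePoint _) :=
    fun a ha => c.collapseP_ofInterior_j ν hkl a ha
  -- description of the points of `NP`
  have memNP : ∀ x : ManifoldInterior (m + 1) (c.surgery ν hkl).W, ClosedModel.ofInterior x ∈ NP →
      ∃ (a : ↥S.A) (ha : (a : c.W) ∈ (𝓡∂ (m + 1 + 1)).interior c.W),
        (a : c.W) ∈ c.collarBelow κ ε ∧ x = ⟨S.j a, S.j_mem_interior ha⟩ := by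
    intro x hx
    rcases (mem_insert_iff).1 hx with h | ⟨x', hx', hx'x⟩
    · exact absurd h (OnePoint.coe_ne_infty _)
    · have hxx : x' = x := OnePoint.coe_injective hx'x
      subst hxx
      obtain ⟨a, ha, hax⟩ := hx'
      have haint : (a : c.W) ∈ (𝓡∂ (m + 1 + 1)).interior c.W :=
        c.mem_interior_of_j_mem_interior ν hkl (hax ▸ x'.2)
      exact ⟨a, haint, ha, Subtype.ext hax.symm⟩
  have memNX : ∀ x : ManifoldInterior (m + 1) c.W, ClosedModel.ofInterior x ∈ NX →
      x.1 ∈ c.collarBelow κ ε := by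
    intro x hx
    rcases (mem_insert_iff).1 hx with h | ⟨x', hx', hx'x⟩
    · exact absurd h (OnePoint.coe_ne_infty _)
    · have hxx : x' = x := OnePoint.coe_injective hx'x
      subst hxx; exact hx'
  -- injectivity
  have hinjX : Injective fX := by
    rintro ⟨y₁, hy₁⟩ ⟨y₂, hy₂⟩ h
    apply Subtype.ext
    change c.collapseX ν hkl y₁ = c.collapseX ν hkl y₂ at h
    induction y₁ using OnePoint.rec with
    | infty =>
      induction y₂ using OnePoint.rec with
      | infty => rfl
      | coe x₂ =>
        rw [c.collapseX_infty, vX x₂ (memNX x₂ hy₂)] at h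
        exact absurd h.symm (OnePoint.coe_ne_infty _)
    | coe x₁ =>
      induction y₂ using OnePoint.rec with
      | infty =>
        rw [c.collapseX_infty, vX x₁ (memNX x₁ hy₁)] at h
        exact absurd h (OnePoint.coe_ne_infty _)
      | coe x₂ =>
        rw [vX x₁ (memNX x₁ hy₁), vX x₂ (memNX x₂ hy₂)] at h
        have h' := congrArg (fun v : ↥(c.commonPiece ν) => v.1.val) (OnePoint.coe_injective h)
        have hx : x₁ = x₂ := Subtype.ext h'
        subst hx; rfl
  have hinjP : Injective fP := by
    rintro ⟨y₁, hy₁⟩ ⟨y₂, hy₂⟩ h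
    apply Subtype.ext
    change c.collapseP ν hkl y₁ = c.collapseP ν hkl y₂ at h
    induction y₁ using OnePoint.rec with
    | infty =>
      induction y₂ using OnePoint.rec with
      | infty => rfl
      | coe x₂ =>
        obtain ⟨a₂, ha₂, -, rfl⟩ := memNP x₂ hy₂
        rw [c.collapseP_infty, vP a₂ ha₂] at h
        exact absurd h.symm (OnePoint.coe_ne_infty _)
    | coe x₁ =>
      obtain ⟨a₁, ha₁, -, rfl⟩ := memNP x₁ hy₁
      induction y₂ using OnePoint.rec with
      | infty =>
        rw [c.collapseP_infty, vP a₁ ha₁] at h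
        exact absurd h (OnePoint.coe_ne_infty _)
      | coe x₂ =>
        obtain ⟨a₂, ha₂, -, rfl⟩ := memNP x₂ hy₂
        rw [vP a₁ ha₁, vP a₂ ha₂] at h
        have h' := congrArg (fun v : ↥(c.commonPiece ν) => v.1.val) (OnePoint.coe_injective h)
        have haa : a₁ = a₂ := Subtype.ext h'
        subst haa; rfl
  -- the common image
  have hrange : range fX = range fP := by
    ext z; constructor
    · rintro ⟨⟨y, hy⟩, rfl⟩
      change c.collapseX ν hkl y ∈ range fP
      induction y using OnePoint.rec with
      | infty => exact ⟨⟨ClosedModel.infty, mem_insert _ _⟩, by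
          show c.collapseP ν hkl ClosedModel.infty = c.collapseX ν hkl ClosedModel.infty
          rw [c.collapseP_infty, c.collapseX_infty]⟩
      | coe x =>
        have hx := memNX x hy
        let a : ↥S.A := ⟨x.1, hCBcompl hx⟩
        refine ⟨⟨ClosedModel.ofInterior ⟨S.j a, S.j_mem_interior x.2⟩,
          mem_insert_of_mem _ ⟨_, ⟨a, hx, rfl⟩, rfl⟩⟩, ?_⟩
        show c.collapseP ν hkl (ClosedModel.ofInterior ⟨S.j a, S.j_mem_interior x.2⟩) =
          c.collapseX ν hkl (ClosedModel.ofInterior x)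
        rw [vP a x.2, vX x hx]; rfl
    · rintro ⟨⟨y, hy⟩, rfl⟩
      change c.collapseP ν hkl y ∈ range fX
      induction y using OnePoint.rec with
      | infty => exact ⟨⟨ClosedModel.infty, mem_insert _ _⟩, by
          show c.collapseX ν hkl ClosedModel.infty = c.collapseP ν hkl ClosedModel.infty
          rw [c.collapseP_infty, c.collapseX_infty]⟩
      | coe x =>
        obtain ⟨a, ha, haCB, rfl⟩ := memNP x hy
        refine ⟨⟨ClosedModel.ofInterior ⟨(a : c.W), ha⟩, mem_insert_of_mem _ ⟨⟨(a : c.W), ha⟩, haCB, rfl⟩⟩, ?_⟩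
        show c.collapseX ν hkl (ClosedModel.ofInterior ⟨(a : c.W), ha⟩) =
          c.collapseP ν hkl (ClosedModel.ofInterior ⟨S.j a, S.j_mem_interior ha⟩)
        rw [vX ⟨(a : c.W), ha⟩ haCB, vP a ha]; rfl
  -- the homeomorphism of the compact closures
  let eX : ↥NX ≃ₜ ↥(range fX) := (hfXc.isClosedEmbedding hinjX).isEmbedding.toHomeomorph
  let eP : ↥NP ≃ₜ ↥(range fP) := (hfPc.isClosedEmbedding hinjP).isEmbedding.toHomeomorph
  let Φ : ↥NP ≃ₜ ↥NX := eP.trans ((Homeomorph.setCongr hrange.symm).trans eX.symm)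
  have hΦ : ∀ y : ↥NP, fX (Φ y) = fP y := by
    intro y
    have h1 : (eX (Φ y) : c.collapseTarget ν) = fX (Φ y) :=
      (hfXc.isClosedEmbedding hinjX).isEmbedding.toHomeomorph_apply_coe _
    have h2 : eX (Φ y) = (Homeomorph.setCongr hrange.symm) (eP y) := by
      change eX (eX.symm _) = _; rw [Homeomorph.apply_symm_apply]; rfl
    rw [← h1, h2]
    exact (hfPc.isClosedEmbedding hinjP).isEmbedding.toHomeomorph_apply_coe y
  -- the open parts correspond: characterisation through `Z`
  let NZo : Set (c.collapseTarget ν) := insert OnePoint.infty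
    ((↑) '' {v : ↥(c.commonPiece ν) | v.1.val ∈ c.collarNhd κ ε})
  have coe_mem_NZo : ∀ v : ↥(c.commonPiece ν), (v : OnePoint ↥(c.commonPiece ν)) ∈ NZo ↔
      v.1.val ∈ c.collarNhd κ ε := by
    intro v
    change (v : OnePoint ↥(c.commonPiece ν)) ∈ insert _ _ ↔ _
    rw [mem_insert_iff, OnePoint.coe_injective.mem_set_image]
    simp only [OnePoint.coe_ne_infty, false_or, mem_setOf_eq]
  have mX : ∀ y : ↥NX, fX y ∈ NZo ↔ (y : ClosedModel (m + 1) c.W) ∈ c.coneNhd κ ε := by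
    rintro ⟨y, hy⟩
    change c.collapseX ν hkl y ∈ NZo ↔ y ∈ c.coneNhd κ ε
    induction y using OnePoint.rec with
    | infty =>
      rw [c.collapseX_infty]
      exact ⟨fun _ => c.infty_mem_coneNhd κ ε, fun _ => mem_insert _ _⟩
    | coe x =>
      rw [vX x (memNX x hy), coe_mem_NZo]
      exact (c.ofInterior_mem_coneNhd_iff κ x).symm
  have mP : ∀ y : ↥NP, fP y ∈ NZo ↔ (y : ClosedModel (m + 1) (c.surgery ν hkl).W) ∈ c.coneP ν hkl κ ε := by
    rintro ⟨y, hy⟩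
    change c.collapseP ν hkl y ∈ NZo ↔ y ∈ c.coneP ν hkl κ ε
    induction y using OnePoint.rec with
    | infty =>
      rw [c.collapseP_infty]
      exact ⟨fun _ => mem_insert _ _, fun _ => mem_insert _ _⟩
    | coe x =>
      obtain ⟨a, ha, haCB, rfl⟩ := memNP x hy
      rw [vP a ha, coe_mem_NZo, c.ofInterior_mem_coneP_iff ν hkl κ]
      change (a : c.W) ∈ c.collarNhd κ ε ↔ S.j a ∈ c.collarP ν hkl κ ε
      constructor
      · intro h; exact ⟨a, h, rfl⟩
      · rintro ⟨a', ha', ha'a⟩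
        have : a' = a := S.j_injective ha'a
        subst this; exact ha'
  have hcorr : ∀ y : ↥NP, (y : ClosedModel (m + 1) (c.surgery ν hkl).W) ∈ c.coneP ν hkl κ ε ↔
      ((Φ y : ↥NX) : ClosedModel (m + 1) c.W) ∈ c.coneNhd κ ε := fun y => by
    rw [← mP y, ← mX (Φ y), hΦ y]
  -- assemble
  have hsubP : c.coneP ν hkl κ ε ⊆ NP := by
    intro y hy
    rcases (mem_insert_iff).1 hy with rfl | ⟨x, hx, rfl⟩
    · exact mem_insert _ _
    · obtain ⟨a, ha, hax⟩ := hx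
      exact mem_insert_of_mem _ ⟨x, ⟨a, c.collarNhd_subset_collarBelow κ ε ha, hax⟩, rfl⟩
  have hsubX : c.coneNhd κ ε ⊆ NX := by
    intro y hy
    rcases (mem_insert_iff).1 hy with rfl | ⟨x, hx, rfl⟩
    · exact mem_insert _ _
    · exact mem_insert_of_mem _ ⟨x, c.collarNhd_subset_collarBelow κ ε hx, rfl⟩
  refine ⟨(Homeomorph.setSubtypeOfSubset hsubP).trans
    ((Φ.subtype (p := fun y : ↥NP => (y : ClosedModel (m + 1) (c.surgery ν hkl).W) ∈ c.coneP ν hkl κ ε)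
      (q := fun y : ↥NX => (y : ClosedModel (m + 1) c.W) ∈ c.coneNhd κ ε) hcorr).trans
      (Homeomorph.setSubtypeOfSubset hsubX).symm)⟩

/-- **`Hʲ(N'_ε; ℤ) = 0` for `j ≠ 0`**: the thin cone neighbourhood of `∞` in `χ̂` is
homeomorphic to the (contractible) one of `Ŵ`. [cite: HatcherAT2002, §3.1 pp. 203–204] -/
theorem isZero_singularCohomology_coneP [CompactSpace M] [T2Space M] [Nonempty M] {ε : ℝ}
    (hε1 : ε ≤ 1) (hthin : Disjoint (c.collarBelow κ ε) (c.closedUnitTube ν)) {j : ℕ} (hj : j ≠ 0) :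
    IsZero (singularCohomology ℤ ℤ ↥(c.coneP ν hkl κ ε) j) := by
  obtain ⟨e⟩ := c.nonempty_coneP_homeomorph_coneNhd ν hkl κ hthin
  exact (c.isZero_singularCohomology_coneNhd' κ hε1 hj).of_iso (singularCohomology.mapIso ℤ ℤ e j).symm

end Cone

/-! ### §4 Cohomology of the ends -/

section Ends

/-- **Cohomology of a disjoint union of two open pieces vanishes when it vanishes on each piece**
(Mayer–Vietoris with empty intersection, Hatcher 2002, §3.1 pp. 203–204). [cite: HatcherAT2002, §3.1 pp. 203–204] -/
theorem isZero_singularCohomology_union_of_disjoint {Y : Type} [TopologicalSpace Y] {T N : Set Y}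
    (hT : IsOpen T) (hN : IsOpen N) (hTN : T ∩ N = ∅) {j : ℕ} (hj : j ≠ 0)
    (hT0 : IsZero (singularCohomology ℤ ℤ ↥T j)) (hN0 : IsZero (singularCohomology ℤ ℤ ↥N j)) :
    IsZero (singularCohomology ℤ ℤ ↥(T ∪ N) j) := by
  obtain ⟨p, rfl⟩ : ∃ p, j = p + 1 := ⟨j - 1, by omega⟩
  set A : Set ↥(T ∪ N) := Subtype.val ⁻¹' T with hA
  set B : Set ↥(T ∪ N) := Subtype.val ⁻¹' N with hB
  have hAo : IsOpen A := hT.preimage continuous_subtype_val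
  have hBo : IsOpen B := hN.preimage continuous_subtype_val
  have hAB : A ∪ B = univ := by
    ext y; simp only [mem_union, mem_univ, iff_true]; exact y.2
  have hABe : A ∩ B = ∅ := by
    ext y; simp only [mem_inter_iff, mem_empty_iff_false, iff_false, not_and]
    intro h1 h2
    have : (y : Y) ∈ T ∩ N := ⟨h1, h2⟩
    rw [hTN] at this; exact this
  have eA : ↥T ≃ₜ ↥A := Homeomorph.setSubtypeOfSubset subset_union_left
  have eB : ↥N ≃ₜ ↥B := Homeomorph.setSubtypeOfSubset subset_union_right
  have hA0 : IsZero (singularCohomology ℤ ℤ ↥A (p + 1)) :=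
    hT0.of_iso (singularCohomology.mapIso ℤ ℤ eA (p + 1))
  have hB0 : IsZero (singularCohomology ℤ ℤ ↥B (p + 1)) :=
    hN0.of_iso (singularCohomology.mapIso ℤ ℤ eB (p + 1))
  have hall : ∀ c : singularCohomology ℤ ℤ ↥(T ∪ N) (p + 1), c = 0 := fun c => by
    haveI := ModuleCat.subsingleton_of_isZero hA0
    haveI := ModuleCat.subsingleton_of_isZero hB0
    have ha : singularCohomology.map ℤ ℤ (subsetIncl A) (p + 1) c = 0 := Subsingleton.elim _ _
    have hb : singularCohomology.map ℤ ℤ (subsetIncl B) (p + 1) c = 0 := Subsingleton.elim _ _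
    exact singularCohomology.eq_zero_of_map_subsetIncl_eq_zero ℤ hAo hBo hAB
      (isZero_singularCohomology_inter_of_disjoint hABe p) c ha hb
  haveI : Subsingleton (singularCohomology ℤ ℤ ↥(T ∪ N) (p + 1)) :=
    ⟨fun a b => (hall a).trans (hall b).symm⟩
  exact ModuleCat.isZero_of_subsingleton _

variable (κ : c.boundaryData.Collar)

include hkl in
/-- **`Hʲ(T̂ ⊔ N_ε; ℤ) = 0` for `2 ≤ j ≠ k`** (the ends of `Ŵ` off `q(K₀)`, for a thin collar).
[cite: KervaireMilnorAnnals1963, §5 (Lemma 5.6)] -/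
theorem isZero_singularCohomology_endsX [CompactSpace M] [Nonempty M] {ε : ℝ} (hε0 : 0 < ε)
    (hε1 : ε ≤ 1) (hthin : Disjoint (c.collarBelow κ ε) (c.closedUnitTube ν))
    {j : ℕ} (hj : 2 ≤ j) (hjk : j ≠ k) :
    IsZero (singularCohomology ℤ ℤ ↥(c.tubeHat ν ∪ c.coneNhd κ ε) j) :=
  isZero_singularCohomology_union_of_disjoint (c.isOpen_tubeHat ν hkl) (c.isOpen_coneNhd κ hε0 hε1)
    (c.tubeHat_inter_coneNhd_eq_empty ν hkl κ hthin) (by omega)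
    (c.isZero_singularCohomology_tubeHat ν hkl hj hjk)
    (c.isZero_singularCohomology_coneNhd' κ hε1 (by omega))

/-- **`Hʲ(T̂' ⊔ N'_ε; ℤ) = 0` for `2 ≤ j ≠ l`** (the ends of `χ̂` off `q'(inl K₀)`, for a thin
collar). [cite: KervaireMilnorAnnals1963, §5 (Lemma 5.6)] -/
theorem isZero_singularCohomology_endsP [CompactSpace M] [Nonempty M] [T2Space M] {ε : ℝ}
    (hε0 : 0 < ε) (hε1 : ε ≤ 1) (hthin : Disjoint (c.collarBelow κ ε) (c.closedUnitTube ν))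
    {j : ℕ} (hj : 2 ≤ j) (hjl : j ≠ l) :
    IsZero (singularCohomology ℤ ℤ ↥(c.handleHat ν hkl ∪ c.coneP ν hkl κ ε) j) :=
  isZero_singularCohomology_union_of_disjoint (c.isOpen_handleHat ν hkl) (c.isOpen_coneP ν hkl κ hε0 hε1)
    (c.handleHat_inter_coneP_eq_empty ν hkl κ hthin) (by omega)
    (c.isZero_singularCohomology_handleHat ν hkl hj hjl)
    (c.isZero_singularCohomology_coneP ν hkl κ hε1 hthin (by omega))

end Ends

/-! ### §5 The compact part `K₀` of `U` and the exact sequences of the pairs -/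

section Pairs

variable (κ : c.boundaryData.Collar)

omit [IsManifold (𝓡 (m + 1)) ∞ M] in
/-- **The compact part `K₀ ⊆ U`** (the points off the open unit tube and off the thin collar),
seen in the common piece. [cite: KervaireMilnorAnnals1963, §7, footnote pp. 528–529] -/
def K₀U (ε : ℝ) : Set ↥(c.commonPiece ν) := {v | v.1.val ∈ c.awaySet ν κ ε}

/-- `K₀` is compact in `U`. [folklore] -/
theorem isCompact_K₀U [CompactSpace M] {ε : ℝ} (hε0 : 0 < ε) (hε1 : ε ≤ 1) :
    IsCompact (c.K₀U ν κ ε) := by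
  have hf : IsEmbedding (fun v : ↥(c.commonPiece ν) => v.1.val) :=
    InteriorManifold.isEmbedding_val.comp IsEmbedding.subtypeVal
  rw [hf.isCompact_iff]
  convert c.isCompact_awaySet ν κ hε1 using 1
  ext x; constructor
  · rintro ⟨v, hv, rfl⟩; exact hv
  · intro hx
    exact ⟨⟨⟨x, c.awaySet_subset_interior ν κ hε0 hx⟩, c.awaySet_subset_complement ν κ ε hx⟩, hx, rfl⟩

/-- `ι_X(K₀) = q(K₀)`. [folklore] -/
theorem image_ιX_K₀U {ε : ℝ} (hε0 : 0 < ε) :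
    c.ιX ν hkl '' c.K₀U ν κ ε = boundaryCollapse (m + 1) c.W '' c.awaySet ν κ ε := by
  ext y; constructor
  · rintro ⟨v, hv, rfl⟩; exact ⟨v.1.val, hv, rfl⟩
  · rintro ⟨x, hx, rfl⟩
    exact ⟨⟨⟨x, c.awaySet_subset_interior ν κ hε0 hx⟩, c.awaySet_subset_complement ν κ ε hx⟩, hx, rfl⟩

/-- `ι_P(K₀) = q'(inl K₀)`. [folklore] -/
theorem image_ιP_K₀U {ε : ℝ} (hε0 : 0 < ε) :
    c.ιP ν hkl '' c.K₀U ν κ ε = boundaryCollapse (m + 1) (c.surgery ν hkl).W ''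
      ((c.surgeryPiece ν hkl).j '' {a | (a : c.W) ∈ c.awaySet ν κ ε}) := by
  ext y; constructor
  · rintro ⟨v, hv, rfl⟩; exact ⟨_, ⟨c.pieceIncl ν hkl v, hv, rfl⟩, rfl⟩
  · rintro ⟨_, ⟨a, ha, rfl⟩, rfl⟩
    exact ⟨c.uPtA ν hkl a (c.awaySet_subset_interior ν κ hε0 ha), ha, rfl⟩

/-- **`Ŵ ∖ ι_X(K₀) = T̂ ∪ N_ε`.** [cite: KervaireMilnorAnnals1963, §7, footnote pp. 528–529] -/
theorem compl_image_ιX_K₀U {ε : ℝ} (hε0 : 0 < ε) :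
    (c.ιX ν hkl '' c.K₀U ν κ ε)ᶜ = c.tubeHat ν ∪ c.coneNhd κ ε := by
  rw [c.image_ιX_K₀U ν hkl κ hε0, c.compl_image_boundaryCollapse_awaySet ν hkl κ hε0]

/-- **`χ̂ ∖ ι_P(K₀) = T̂' ∪ N'_ε`.** [cite: KervaireMilnorAnnals1963, §7, footnote pp. 528–529] -/
theorem compl_image_ιP_K₀U {ε : ℝ} (hε0 : 0 < ε) :
    (c.ιP ν hkl '' c.K₀U ν κ ε)ᶜ = c.handleHat ν hkl ∪ c.coneP ν hkl κ ε := by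
  rw [c.image_ιP_K₀U ν hkl κ hε0, c.compl_image_boundaryCollapse_awaySet_P ν hkl κ hε0]

/-- **`Hᵖ(Ŵ, Ŵ ∖ ι_X K₀) → Hᵖ(Ŵ)` is onto for `2 ≤ p`, `p ≠ k`** (`Hᵖ(Ŵ ∖ ι_X K₀) = 0` and the
exact sequence of the pair, Hatcher §3.1 p. 200). [cite: HatcherAT2002, §3.1 p. 200] -/
theorem surjective_toAbsolute_X [CompactSpace M] [Nonempty M] {ε : ℝ} (hε0 : 0 < ε) (hε1 : ε ≤ 1)
    (hthin : Disjoint (c.collarBelow κ ε) (c.closedUnitTube ν)) {p : ℕ} (hp : 2 ≤ p) (hpk : p ≠ k) :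
    Surjective (relSingularCohomology.toAbsolute ℤ ℤ (ClosedModel (m + 1) c.W)
      ((c.ιX ν hkl '' c.K₀U ν κ ε)ᶜ) p) := by
  have hex := relSingularCohomology.exact_toAbsolute_map (R := ℤ) (M := ℤ)
    (X := ClosedModel (m + 1) c.W) ((c.ιX ν hkl '' c.K₀U ν κ ε)ᶜ) p
  have hZ : IsZero (singularCohomology ℤ ℤ ↥((c.ιX ν hkl '' c.K₀U ν κ ε)ᶜ) p) := by
    rw [c.compl_image_ιX_K₀U ν hkl κ hε0]
    exact c.isZero_singularCohomology_endsX ν hkl κ hε0 hε1 hthin hp hpk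
  rw [← ModuleCat.epi_iff_surjective]
  exact hex.epi_f (hZ.eq_of_tgt _ _)

/-- **`Hᵖ(χ̂, χ̂ ∖ ι_P K₀) → Hᵖ(χ̂)` is onto for `2 ≤ p`, `p ≠ l`.** [cite: HatcherAT2002, §3.1 p. 200] -/
theorem surjective_toAbsolute_P [CompactSpace M] [Nonempty M] [T2Space M] {ε : ℝ} (hε0 : 0 < ε)
    (hε1 : ε ≤ 1) (hthin : Disjoint (c.collarBelow κ ε) (c.closedUnitTube ν)) {p : ℕ} (hp : 2 ≤ p)
    (hpl : p ≠ l) :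
    Surjective (relSingularCohomology.toAbsolute ℤ ℤ (ClosedModel (m + 1) (c.surgery ν hkl).W)
      ((c.ιP ν hkl '' c.K₀U ν κ ε)ᶜ) p) := by
  have hex := relSingularCohomology.exact_toAbsolute_map (R := ℤ) (M := ℤ)
    (X := ClosedModel (m + 1) (c.surgery ν hkl).W) ((c.ιP ν hkl '' c.K₀U ν κ ε)ᶜ) p
  have hZ : IsZero (singularCohomology ℤ ℤ ↥((c.ιP ν hkl '' c.K₀U ν κ ε)ᶜ) p) := by
    rw [c.compl_image_ιP_K₀U ν hkl κ hε0]
    exact c.isZero_singularCohomology_endsP ν hkl κ hε0 hε1 hthin hp hpl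
  rw [← ModuleCat.epi_iff_surjective]
  exact hex.epi_f (hZ.eq_of_tgt _ _)

/-- **`Hᵖ(χ̂, χ̂ ∖ ι_P K₀) → Hᵖ(χ̂)` is into for `3 ≤ p`, `p - 1 ≠ l`** (`Hᵖ⁻¹(χ̂ ∖ ι_P K₀) = 0`
and the exact sequence of the pair). [cite: HatcherAT2002, §3.1 p. 200] -/
theorem injective_toAbsolute_P [CompactSpace M] [Nonempty M] [T2Space M] {ε : ℝ} (hε0 : 0 < ε)
    (hε1 : ε ≤ 1) (hthin : Disjoint (c.collarBelow κ ε) (c.closedUnitTube ν)) {p : ℕ} (hp : 3 ≤ p)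
    (hpl : p - 1 ≠ l) :
    Injective (relSingularCohomology.toAbsolute ℤ ℤ (ClosedModel (m + 1) (c.surgery ν hkl).W)
      ((c.ιP ν hkl '' c.K₀U ν κ ε)ᶜ) p) := by
  obtain ⟨q, rfl⟩ : ∃ q, p = q + 1 := ⟨p - 1, by omega⟩
  have hex := relSingularCohomology.exact_δ_toAbsolute (R := ℤ) (M := ℤ)
    (X := ClosedModel (m + 1) (c.surgery ν hkl).W) ((c.ιP ν hkl '' c.K₀U ν κ ε)ᶜ) q (q + 1) rfl
  have hZ : IsZero (singularCohomology ℤ ℤ ↥((c.ιP ν hkl '' c.K₀U ν κ ε)ᶜ) q) := by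
    rw [c.compl_image_ιP_K₀U ν hkl κ hε0]
    exact c.isZero_singularCohomology_endsP ν hkl κ hε0 hε1 hthin (by omega) (by omega)
  rw [← ModuleCat.mono_iff_injective]
  exact hex.mono_g (hZ.eq_of_src _ _)

end Pairs

end NullCobordism

end Literature.Topology.FourManifolds
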